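import Summits.Parity.GeneralizedHardyLittlewood.Theorems.DicksonFibrationDimOneDefs
import Summits.Parity.GeneralizedHardyLittlewood.Theorems.DicksonFibrationDimOneStubSieveCountAux1
import Literature.NumberTheory.Sieve.SieveFrameworkFundamentalLemma
import HarnessLib

/-!
# Route `DicksonFibration`, crux `DimOne` (stmt-Parity-0819), line `birth` (sieve-model reshape):
# the stub `stub_sieveCount` — the Fundamental Lemma for the values of a one-dimensional system

We prove the registered stub `stub_sieveCount : SieveCount` of the skeleton of the crux `DimOne`
(vocabulary file `Theorems/DicksonFibrationDimOneDefs.lean`): uniformly over non-degenerate systems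
`Ψ` of `t` forms `ψ_k(m) = a_k m + b_k` with `‖Ψ‖_N ≤ L` and integer intervals `I = [m₁, m₂] ⊆ [−N, N]`
on which every form is `≥ 1`,
`|(P/φ(P))^t · #{m ∈ I : (ψ_k(m), P) = 1 ∀ k} − #I · ∏_{p ≤ ⌊y⌋} β_p(Ψ)| ≤ ε N` for `N ≥ N₀(t, L, ε)`,
where `y = y_N = N^{1/u}`, `u = u_N = ⌈√(log N)⌉`, `P = P_N = ∏_{p ≤ ⌊y⌋} p`.

Proof (the textbook application of the Fundamental Lemma of sieve theory, tree
`SieveSequence.fundamental_lemma_uniform_holds`, to the value sequence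
`AbsoluteUpgrade.valSeq F_Ψ I #I` of `F_Ψ = ∏_k (a_k X + b_k)`, sifted by the primes `< z = ⌊y⌋ + 1`,
so that `P(z) = P_N` exactly, at level `D = N^{1/8}`):

* the condition `(ψ_k(m), P) = 1 ∀ k` is `(F_Ψ(m), P) = 1` (`F_Ψ(m) = ∏_k ψ_k(m)`), so the count is the
  sifting function `S(𝒜, z)` (`valSeq_sifted`);
* `|S(𝒜, z) − #I · V(z)| ≤ C_FL #I V(z) e^{−log D/log z} + ∑_{d ∣ P(z), d ≤ D} |R_d|` with
  `|R_d| ≤ ω_F(d) ≤ d ≤ D` and at most `D` moduli, so the remainder is `≤ D² = N^{1/4}`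
  (helper file 1, `abs_sifted_card_sub_le`); off the local obstructions the root density `ω_F(m)/m` has sieve
  dimension `2(L + t)` (`AbsoluteUpgrade.hasSieveDimension_sysPoly`), and AT a local obstruction
  (`ω_F(p) = p` for some prime `p`, necessarily `p ≤ L + t ≤ ⌊y⌋`) both `S(𝒜, z)` and `V(z)` vanish;
* the main terms agree exactly: `V(z) = ∏_{p<z} (1 − ω_F(p)/p) = (∏_{p ≤ ⌊y⌋} β_p) (∏_{p ≤ ⌊y⌋} (1 − 1/p))^t`
  (`AbsoluteUpgrade.prod_one_sub_rootCount_eq`) and `φ(P)/P = ∏_{p ≤ ⌊y⌋} (1 − 1/p)`, so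
  `(P/φ(P))^t V(z) = ∏_{p ≤ ⌊y⌋} β_p` (helper file 1, `weight_pow_mul_prod_eq`);
* numerics: `P/φ(P) ≤ e⁵ log ⌊y⌋ ≤ e⁵ log N` (Mertens), `∏_{p ≤ ⌊y⌋} β_p ≤ (P/φ(P))^t`, `#I ≤ 3N`,
  `e^{−log D/log z} ≤ e^{−u/16}` and `(log N)^t ≤ u^{2t}`, so the error is
  `≤ 3 C_FL N (e⁵)^t u^{2t} e^{−u/16} + (e⁵ log N)^t N^{1/4} = o(N)` since `u = ⌈√(log N)⌉ → ∞`
  (thresholds `eventually_roughLevel`, `eventually_decay`, `eventually_pow_log_mul_rpow` of helper file 1,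
  `Theorems/DicksonFibrationDimOneStubSieveCountAux1.lean`).

References: H. Halberstam, H.-E. Richert, *Sieve Methods* (1974), Thm. 2.5 and §5.7
[HalberstamRichert1974]; J. Friedlander, H. Iwaniec, *Opera de Cribro* (2010), Cor. 6.10
[FriedlanderIwaniecOpera2010]; B. Green, T. Tao, Ann. of Math. 171 (2010), (1.5)–(1.7)
[GreenTao2010].
-/

noncomputable section

open scoped BigOperators Classical
open Finset Filter Polynomial Literature.NumberTheory.Sieve
open Summit.Parity.GeneralizedHardyLittlewood.Theorems.AbsoluteUpgrade

namespace Summit.Parity.GeneralizedHardyLittlewood.Cruxes.DimOne.BirthSieve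

/-- **S♯-count (`stub_sieveCount`) — the Fundamental Lemma for the values of a one-dimensional
system.** Uniformly over non-degenerate `Ψ` of `t` forms with `‖Ψ‖_N ≤ L` and integer intervals
`I = [m₁, m₂] ⊆ [−N, N]` on which every form is `≥ 1`:
`|(P_N/φ(P_N))^t · #{m ∈ I : (ψ_k(m), P_N) = 1 ∀ k} − #I · ∏_{p ≤ ⌊y_N⌋} β_p(Ψ)| ≤ ε N` for
`N ≥ N₀(t, L, ε)`. See the module docstring for the proof.
[cite: HalberstamRichert1974, Thm. 2.5 and §5.7] -/
theorem stub_sieveCount : SieveCount := by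
  intro t L ε hε
  -- the Fundamental Lemma in dimension `2(L + t)` (constant depending on `t, L` only)
  obtain ⟨CFL, hCFL0, hFL⟩ := SieveSequence.fundamental_lemma_uniform_holds (2 * ((L + t : ℕ) : ℝ))
    (((2 * (L + t) + 1 : ℕ) : ℝ) ^ (2 * (L + t) + 1) *
      Real.exp (2 * ((L + t : ℕ) : ℝ) * (9 / 2 + 6 / Real.log 2)))
  -- thresholds
  have hc1 : (1 : ℝ) ≤ ((L + t + 2 : ℕ) : ℝ) := by exact_mod_cast (by omega : 1 ≤ L + t + 2)
  have hA0 : (0 : ℝ) ≤ Real.exp 5 ^ t := by positivity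
  obtain ⟨N₀, hN₀⟩ := Filter.eventually_atTop.mp ((eventually_roughLevel _ hc1).and
    ((eventually_decay t hA0 (show 0 < ε / (6 * CFL) by positivity)).and
      (eventually_pow_log_mul_rpow t hA0 (half_pos hε))))
  refine ⟨N₀, fun N hN Ψ hΨ hL m₁ m₂ hI => ?_⟩
  obtain ⟨⟨hN1, hu17, hyc, hzD⟩, hdec, hpol⟩ := hN₀ N hN
  -- notation
  set u : ℕ := roughExp N with hu
  set y : ℝ := roughLevel N with hy
  set n : ℕ := ⌊y⌋₊ with hn
  set z : ℝ := ((n + 1 : ℕ) : ℝ) with hz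
  set I := Icc m₁ m₂ with hIdef
  set F := sysPoly Ψ with hF
  set V := ∏ p ∈ Nat.primesBelow ⌈z⌉₊, (1 - (polyRootCountMod ![F] p : ℝ) / p) with hVdef
  set D : ℝ := (N : ℝ) ^ ((1 : ℝ) / 8) with hD
  set E := Real.exp (-(Real.log D / Real.log z)) with hE
  set W := sieveWeight N with hW
  have hP : sieveModulus N = primesProdBelow z := rfl
  have hWdef : W = (primesProdBelow z : ℝ) / (Nat.totient (primesProdBelow z) : ℝ) := rfl
  -- basic facts
  have haL : ∀ k, ((Ψ k).coeff 0).natAbs ≤ L := fun k => natAbs_coeff_le_of_affLinSize_le hL k 0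
  have hIpos : ∀ m ∈ I, ∀ k, 1 ≤ (Ψ k).eval (fun _ => m) := fun m hm => (hI m hm).2
  have hN0 : (0 : ℝ) < N := by linarith
  have hu1 : 1 ≤ u := le_trans (by norm_num) hu17
  have hu0 : (0 : ℝ) < u := by exact_mod_cast hu1
  have hc2 : (2 : ℝ) ≤ ((L + t + 2 : ℕ) : ℝ) := by exact_mod_cast (by omega : 2 ≤ L + t + 2)
  have hy2 : (2 : ℝ) ≤ y := hc2.trans hyc
  have hy0 : (0 : ℝ) ≤ y := by linarith
  have hnc : L + t + 2 ≤ n := Nat.le_floor hyc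
  have hn2 : 2 ≤ n := le_trans (by omega) hnc
  have hz2 : (2 : ℝ) ≤ z := by rw [hz]; exact_mod_cast (by omega : 2 ≤ n + 1)
  have hz1 : (1 : ℝ) < z := by linarith
  have hzle : z ≤ 2 * y := by
    rw [hz]; push_cast; linarith [Nat.floor_le hy0]
  have hceil : ⌈z⌉₊ = n + 1 := by rw [hz, Nat.ceil_natCast]
  have hyN : y ≤ N := by
    have h : (N : ℝ) ^ ((1 : ℝ) / u) ≤ (N : ℝ) ^ (1 : ℝ) :=
      Real.rpow_le_rpow_of_exponent_le hN1 ((div_le_one hu0).mpr (by exact_mod_cast hu1))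
    rw [Real.rpow_one] at h
    exact h
  -- Step 1: coprimality form by form is coprimality of the product `F_Ψ(m) = ∏_k ψ_k(m)`
  have hfilter : I.filter (fun m : ℤ => ∀ k, Int.gcd ((Ψ k).eval (fun _ => m)) (sieveModulus N) = 1) =
      I.filter (fun m : ℤ => (F.eval m).natAbs.Coprime (primesProdBelow z)) := by
    refine Finset.filter_congr fun m _ => ?_
    rw [hF, sysPoly_eval, hP]
    have hprod : (∏ k, (Ψ k).eval (fun _ => m)).natAbs = ∏ k, ((Ψ k).eval (fun _ => m)).natAbs :=
      map_prod Int.natAbsHom (fun k => (Ψ k).eval (fun _ => m)) univ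
    rw [hprod, Nat.coprime_prod_left_iff]
    simp only [Finset.mem_univ, forall_const, Int.gcd_def, Int.natAbs_natCast, Nat.coprime_iff_gcd_eq_one]
  -- Step 2: the Fundamental Lemma (both sides vanish at a local obstruction)
  have hV0 : 0 ≤ V := prod_one_sub_rootCount_nonneg F z
  have hV1 : V ≤ 1 := prod_one_sub_rootCount_le_one F z
  have hE0 : 0 ≤ E := (Real.exp_pos _).le
  have hD0 : 0 ≤ D := by positivity
  have hS : |(#(I.filter (fun m : ℤ => (F.eval m).natAbs.Coprime (primesProdBelow z))) : ℝ) -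
      #I * V| ≤ CFL * #I * V * E + D ^ 2 := by
    by_cases hobs : ∀ p : ℕ, p.Prime → polyRootCountMod ![F] p < p
    · have hdim := hasSieveDimension_sysPoly hΨ haL hobs
      have hFpos : ∀ m ∈ I, 0 < F.eval m ∧
          ((F.eval m : ℤ) : ℝ) ≤ ∑ m' ∈ I, ((F.eval m' : ℤ) : ℝ) := by
        have hpos : ∀ m ∈ I, 0 < F.eval m := fun m hm => by
          rw [hF, sysPoly_eval]
          exact Finset.prod_pos fun k _ => lt_of_lt_of_le zero_lt_one (hIpos m hm k)
        intro m hm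
        refine ⟨hpos m hm, ?_⟩
        have h := Finset.single_le_sum (f := fun m' : ℤ => F.eval m')
          (fun m' hm' => (hpos m' hm').le) hm
        exact_mod_cast h
      exact abs_sifted_card_sub_le hFL hdim hFpos hz2 hzD
    · push Not at hobs
      obtain ⟨p, hp, hple⟩ := hobs
      have hρ : polyRootCountMod ![F] p = p := le_antisymm (polyRootCountMod_le _ p) hple
      have hpn : p ≤ n := by
        have h := rootCount_le_add hΨ haL hp
        rw [← hF, hρ] at h
        omega
      have hempty : I.filter (fun m : ℤ => (F.eval m).natAbs.Coprime (primesProdBelow z)) = ∅ := by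
        refine Finset.filter_eq_empty_iff.mpr fun m _ hcop => ?_
        have h1 : p ∣ (F.eval m).natAbs :=
          Int.natCast_dvd.mp (dvd_eval_of_rootCount_eq F hp.pos hρ m)
        have h2 : p ∣ primesProdBelow z :=
          (dvd_primesProdBelow_iff hp z).mpr (by rw [hz]; exact_mod_cast Nat.lt_succ_of_le hpn)
        have h3 : p ∣ 1 := hcop.gcd_eq_one ▸ Nat.dvd_gcd h1 h2
        exact hp.one_lt.ne' (Nat.dvd_one.mp h3)
      have hVz : V = 0 := by
        rw [hVdef]
        refine Finset.prod_eq_zero (i := p) ?_ ?_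
        · rw [hceil, Nat.mem_primesBelow]
          exact ⟨Nat.lt_succ_of_le hpn, hp⟩
        · rw [hρ, div_self (by exact_mod_cast hp.ne_zero : (p : ℝ) ≠ 0), sub_self]
      rw [hempty, hVz]
      simp only [Finset.card_empty, Nat.cast_zero, mul_zero, zero_mul, sub_zero, abs_zero,
        zero_add]
      positivity
  -- Step 3: the main term and the sieve weight
  have hmain : W ^ t * V = singularProductPartial Ψ n := by
    rw [hWdef, hVdef, hF]
    exact weight_pow_mul_prod_eq Ψ n
  have hW0 : 0 ≤ W := by rw [hWdef]; positivity
  have hWle : W ≤ Real.exp 5 * Real.log N := by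
    have h1 : W ≤ Real.exp 5 * Real.log n := by rw [hWdef]; exact weight_le hn2
    have hn0 : (0 : ℝ) < n := by exact_mod_cast (show 0 < n by omega)
    have h2 : Real.log n ≤ Real.log N :=
      Real.log_le_log hn0 ((Nat.floor_le hy0).trans hyN)
    have h3 := mul_le_mul_of_nonneg_left h2 (Real.exp_pos 5).le
    linarith
  have hWt : W ^ t ≤ Real.exp 5 ^ t * Real.log N ^ t := by
    rw [← mul_pow]
    exact pow_le_pow_left₀ hW0 hWle t
  have hSP0 : 0 ≤ singularProductPartial Ψ n := by rw [← hmain]; positivity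
  have hSP : singularProductPartial Ψ n ≤ W ^ t := by
    rw [← hmain]
    exact mul_le_of_le_one_right (pow_nonneg hW0 t) hV1
  have hXle : (#I : ℝ) ≤ 3 * N := by
    have h1 : #I ≤ #(Icc (-(N : ℤ)) N) := Finset.card_le_card fun m hm => (hI m hm).1
    have h2 : #(Icc (-(N : ℤ)) N) = 2 * N + 1 := by
      rw [Int.card_Icc]
      omega
    rw [h2] at h1
    have h3 : (#I : ℝ) ≤ ((2 * N + 1 : ℕ) : ℝ) := by exact_mod_cast h1
    push_cast at h3
    linarith
  have hy2' : (2 : ℝ) ≤ (N : ℝ) ^ ((1 : ℝ) / u) := hy2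
  have hzle' : z ≤ 2 * (N : ℝ) ^ ((1 : ℝ) / u) := hzle
  have hEle : E ≤ Real.exp (-((1 : ℝ) / 16 * u)) := exp_neg_le_exp_neg_div hu1 hy2' hz1 hzle'
  -- Step 4: the two error terms
  have hT1 : CFL * #I * singularProductPartial Ψ n * E ≤ ε / 2 * N := by
    calc CFL * #I * singularProductPartial Ψ n * E
        ≤ CFL * (3 * N) * (W ^ t) * Real.exp (-((1 : ℝ) / 16 * u)) := by gcongr
      _ ≤ CFL * (3 * N) * (Real.exp 5 ^ t * Real.log N ^ t) * Real.exp (-((1 : ℝ) / 16 * u)) := by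
          gcongr
      _ = CFL * (3 * N) * (Real.exp 5 ^ t * Real.log N ^ t * Real.exp (-((1 : ℝ) / 16 * u))) := by
          ring
      _ ≤ CFL * (3 * N) * (ε / (6 * CFL)) := by gcongr
      _ = ε / 2 * N := by field_simp; ring
  have hT2 : W ^ t * D ^ 2 ≤ ε / 2 * N := by
    have hD2 : D ^ 2 = (N : ℝ) ^ ((1 : ℝ) / 4) := by
      rw [hD, sq, ← Real.rpow_add' (Nat.cast_nonneg N) (by norm_num)]
      norm_num
    rw [hD2]
    calc W ^ t * (N : ℝ) ^ ((1 : ℝ) / 4)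
        ≤ Real.exp 5 ^ t * Real.log N ^ t * (N : ℝ) ^ ((1 : ℝ) / 4) :=
          mul_le_mul_of_nonneg_right hWt (Real.rpow_nonneg (Nat.cast_nonneg N) _)
      _ ≤ ε / 2 * N := hpol
  -- assembly
  rw [hfilter]
  set S : ℝ := (#(I.filter (fun m : ℤ => (F.eval m).natAbs.Coprime (primesProdBelow z))) : ℝ) with hSdef
  have key : W ^ t * S - #I * singularProductPartial Ψ n = W ^ t * (S - #I * V) := by
    rw [← hmain]; ring
  rw [key, abs_mul, abs_of_nonneg (pow_nonneg hW0 t)]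
  calc W ^ t * |S - #I * V| ≤ W ^ t * (CFL * #I * V * E + D ^ 2) :=
        mul_le_mul_of_nonneg_left hS (pow_nonneg hW0 t)
    _ = CFL * #I * (W ^ t * V) * E + W ^ t * D ^ 2 := by ring
    _ = CFL * #I * singularProductPartial Ψ n * E + W ^ t * D ^ 2 := by rw [hmain]
    _ ≤ ε / 2 * N + ε / 2 * N := add_le_add hT1 hT2
    _ = ε * N := by ring

end Summit.Parity.GeneralizedHardyLittlewood.Cruxes.DimOne.BirthSieve

end
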